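import Literature.MathematicalPhysics.QuantumFieldTheory.Balaban1983to89.B7Prop5Cplx
import Literature.MathematicalPhysics.QuantumFieldTheory.Balaban1983to89.B7Prop7Ck
import Literature.MathematicalPhysics.QuantumFieldTheory.Balaban1983to89.B7Ineq149Pairing

/-!
# `Balaban1983to89.B7Ineq149CplxPairing` — T. Bałaban, *Averaging operations for lattice gauge theories*, Commun. Math. Phys. **98**
(1985) 17–51 [Balaban1985Averaging]: **(149)/(157) IN THE PRINTED PAIRING FORM AT THE COMPLEX BACKGROUND `U′U₀`, UNIFORMLY IN `U′`**
— Proposition 7's «Similarly, Proposition 5 may be extended to include analyticity and uniformity statements» (p. 43) for the pairing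
«|⟨(δ/δA)C_j(U′U₀, A), δA⟩| ≦ C₃|A|Q″_j|δA|» with a GENERAL variation `δA` of finitely many bond variables: the Fréchet derivative of
`C_j(U′U₀, ·)(c)` on the variable space `𝔸^S` exists, is the sum of the per-bond columns of `B7Prop5Cplx.prop5_cplx_157_uniform`, and —
with the count behind (141) — has operator norm `≤ 2d·C₃·(Lʲ)²ρ`, constants independent of `U′` and of `j ≤ k`

statement-level skeleton of published theorems with citation tags; proofs where landed; nothing here is a claim about the Yang–Mills mass gap

PDF held: `paper:balaban1985-cmp98-averaging` (journal page = PDF page + 16); pp. 39–43 [PDF 23–27] read from the materialised text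
layer `~/.lit/texts/paper-balaban1985-cmp98-averaging/p0023.txt`–`p0027.txt`.

CITATION HEADER / WHAT IS REPRODUCED.  SKELETON row **B7.Prop7** (cell `lit-balaban`, HOME `run/shared/lean/pub/lit-balaban/`, seat
p06 gen 4 = unit `lit-balaban-p06`; B7 owner r04, referee ref-4).  p. 43, verbatim: *"Proposition 7. For U₀ satisfying (52) and U′ =
e^{iηA′}, |A′| < α₁, α₀, α₁ sufficiently small, the function Q_k(U′U₀, ηA) is analytic in complex variables A′, A, and Proposition 4
holds uniformly in A′. Similarly, Proposition 5 may be extended to include analyticity and uniformity statements. The formulations are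
obvious."*; p. 39 (138): *"(d/dt)F(A + tδA)|_{t=0} = Σ_{b⊂Ω} η^d tr (δF(A)/δA_b)δA_b = ⟨(δ/δA)F(A), δA⟩"*; p. 40 (149): *"|⟨(δ/δA)C_j(U₀,
A), δA⟩| ≦ C₃|A|Q″_j|δA|"*; p. 42: (157).  `B7Prop5Cplx.prop5_cplx_157_uniform` (this seat, file 5) renders (157) at `U′U₀` PER BOND
(`δA = X·δ_b`); THIS FILE is the twin at `U′U₀` of `B7Ineq149Pairing` (gen 3, general unitary background): on `𝔸^S` (any finite bond
set `S`) the map `a ↦ C_j(U′U₀, ins_S a)(c)` is Fréchet differentiable (Prop. 7's analyticity at the complex level backgrounds,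
`B7Prop7Levels.prop7_analyticAt`, and the continuous linear form `B7Prop7Ck.clm_linCovIter_cplx_ins`, r04), its derivative is the
LINEAR FUNCTIONAL of (137)–(138), and pairing it with a general `δa ∈ 𝔸^S` gives the sum of the per-bond columns, hence (149) at `U′U₀`
with the constant `C₃ = C3Cplx d L` of `B7Prop5CplxLevels` — independent of `U′ = e^{B′}` (uniformity) and of `j ≤ k`.

DICTIONARY (as in `B7Ineq149Pairing` / `B7Prop5Cplx`; every level rescaled to `ℤᵈ`): `U′U₀` ↦ `expCfg B′ * U₀` (`‖B′‖ ≤ b′`);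
`C_j(U′U₀, B)(c)` ↦ `CCovIter L (expCfg B′ * U₀) B j z κ` (`c = (z, κ)`); the variables `B_s, s ∈ S` ↦ `a : S → 𝔸` inserted by
`B7Prop3Flat.insCfg S a`; `⟨(δ/δA)C_j, δA⟩(c)` ↦ `fderiv ℂ (a ↦ C_j(ins_S a)(c)) a δa` (= `B7Ineq148.dPair`, (137)); `C₃|A|Q″_j|δA|(c)` ↦
`C3Cplx d L·(Lʲ)²ρ·Σ_{s∈S} kerQdd L j z κ s‖δa s‖`; regime = that of `B7Prop5Cplx` §2 (background smallness `hsmall′`, `hc₃′`, `hb′1`,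
`hE`, `hdX` at `b′`; field radius `ρ > 0` with `hsmall`, `16Lᵏρ < c₃`, `d·C₃·Lᵏρ ≤ 1`), on the closed polydisc `‖a_s‖ ≤ ρ`.

WHAT THIS FILE PROVES (kernel, 0 sorry, standard axioms; theorems only): `hasFDerivAt_CCovIter_cplx_ins` (Fréchet differentiability of
`C_j(U′U₀, ins_S ·)(c)` on the polydisc, `j ≤ k`); `fderiv_CCovIter_cplx_ins_single` (its value on `X·e_s` is the per-bond column
`dCov … (bump s X)` of `prop5_cplx_157_uniform`); **`ineq149_cplx_pairing`** = (149)/(157) at `U′U₀` in the printed pairing form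
`‖D[C_j(U′U₀, ins_S ·)(c)](a) δa‖ ≤ C₃·(Lʲ)²ρ·Σ_{s∈S} kerQdd(c, s)‖δa_s‖` for every `δa ∈ 𝔸^S`, every `j ≤ k`;
`ineq149_cplx_pairing_dPair`; **`opNorm_fderiv_CCovIter_cplx_ins_le`**: `‖D[C_j(U′U₀, ins_S ·)(c)](a)‖ ≤ 2d·C₃·(Lʲ)²ρ`.
DIVERGENCES from print: as in `B7Prop5Cplx` / `B7Ineq149Pairing` (explicit, non-optimal constants; `ℤᵈ`, corner blocks, `U1`/`AvgClosed`;
the variation supported in the chosen finite `S`; the operator bound uses the crude count `2d·L^{jd}`).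
-/

open scoped BigOperators
open NormedSpace Finset Metric

namespace Literature.MathematicalPhysics.QuantumFieldTheory.Balaban1983to89.B7Ineq149CplxPairing

open B7Prop1Explicit B7Prop1Local B7Prop2Explicit B7Prop3Flat B7Prop4Flat B7Eq92Concrete B7Prop3GeneralLinear
  B7Prop4GeneralLevels B7Ineq148 B7Prop5GeneralOperators B7Prop5GeneralInduction B7Prop5CplxLevels B7Prop5Cplx B7Prop7Levels
open B7Prop5Flat (BondIn bump)
open B7Prop5FlatOperator (insCfg_line norm_insCfg_le_of_le)
open B7Prop7Ck (clm_linCovIter_cplx_ins)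
open B7Ineq149Pairing (sum_kerQdd_mul_norm_le)

-- `Site` alone would resolve to the torus sites of `Setup.lean`; re-export the `ℤ^d` sites of `B7Prop1Explicit`.
export B7Prop1Explicit (Site)

variable {d : ℕ}

section Regime

variable {𝔸 : Type*} [NormedRing 𝔸] [NormedAlgebra ℂ 𝔸] [CompleteSpace 𝔸] [NormOneClass 𝔸]

variable (L : ℕ) (hL : 2 ≤ L) {G : Subgroup 𝔸ˣ} (hG : AvgClosed d L G) (k : ℕ)
  (U₀ : Site d → Fin d → 𝔸ˣ) (hU₀ : ∀ x κ, U₀ x κ ∈ G) {α₀ : ℝ} (hα : 0 < α₀)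
  (hα3 : C0 d * α₀ ≤ 1 / 3) (hα8 : 8 * α₀ ≤ c2' d L) (h52 : pdev U₀ < α₀ * (((L : ℝ) ^ k)⁻¹) ^ 2)
  (B' : Site d → Fin d → 𝔸) {b' : ℝ} (hb' : 0 ≤ b') (hB' : ∀ x κ, ‖B' x κ‖ ≤ b')
  (hsmall' : Real.exp (4 * (800 * ((d : ℝ) + 1) ^ 2 * ((d : ℝ) + 4)) * α₀)
    * (1 + 8 * (131072 * ((d : ℝ) + 1) ^ 2) * ((L : ℝ) ^ k * b')) ≤ 2)
  (hc₃' : 2 * ((L : ℝ) ^ k * b') ≤ c3 d L) (hb'1 : 409600 * ((d : ℝ) + 1) ^ 2 * ((L : ℝ) ^ k * b') ≤ 1)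
  (hE : epsCplx d L b' k ≤ 1 / 16) (hdX : (d : ℝ) * (epsCplx d L b' k + tauCplx d L α₀ k b' k) ≤ 1 / 16)
  {ρ : ℝ} (hρ : 0 < ρ)
  (hsmall : Real.exp (4480 * ((d : ℝ) + 1) ^ 2 * ((d : ℝ) + 4) * α₀ + 240000 * ((d : ℝ) + 1) ^ 3 * ((L : ℝ) ^ k * b'))
    * (1 + 8 * (2097152 * ((d : ℝ) + 1) ^ 2) * ((L : ℝ) ^ k * ρ)) ≤ 2)
  (hc₃ : 16 * ((L : ℝ) ^ k * ρ) < c3 d L) (hβ : (d : ℝ) * C3Cplx d L * ((L : ℝ) ^ k * ρ) ≤ 1)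
  (S : Finset (Site d × Fin d)) {a : S → 𝔸} (ha : ∀ s, ‖a s‖ ≤ ρ)

omit [NormedAlgebra ℂ 𝔸] [CompleteSpace 𝔸] [NormOneClass 𝔸] in
include hL hα h52 hb' hsmall' hc₃' hb'1 hρ hsmall hc₃ in
/-- the regime at the level `j ≤ k`: (52) `pdev U₀ < α₀L^{−2j}`, Prop. 7's smallness with `Lʲb′ ≤ Lᵏb′`, `Lʲρ ≤ Lᵏρ`.
[cite: Balaban1985Averaging, p.37 (after (127)), (52) p.26, Proposition 7 p.43] -/
private theorem regime_level {j : ℕ} (hj : j ≤ k) :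
    pdev U₀ < α₀ * (((L : ℝ) ^ j)⁻¹) ^ 2 ∧
      Real.exp (4 * (800 * ((d : ℝ) + 1) ^ 2 * ((d : ℝ) + 4)) * α₀)
          * (1 + 8 * (131072 * ((d : ℝ) + 1) ^ 2) * ((L : ℝ) ^ j * b')) ≤ 2 ∧
      2 * ((L : ℝ) ^ j * b') ≤ c3 d L ∧
      409600 * ((d : ℝ) + 1) ^ 2 * ((L : ℝ) ^ j * b') ≤ 1 ∧
      Real.exp (4480 * ((d : ℝ) + 1) ^ 2 * ((d : ℝ) + 4) * α₀ + 240000 * ((d : ℝ) + 1) ^ 3 * ((L : ℝ) ^ j * b'))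
          * (1 + 8 * (2097152 * ((d : ℝ) + 1) ^ 2) * ((L : ℝ) ^ j * ρ)) ≤ 2 ∧
      2 * ((L : ℝ) ^ j * ρ) ≤ c3 d L / 4 := by
  have hL1r : (1 : ℝ) ≤ L := by exact_mod_cast le_trans (by norm_num) hL
  have hLj : (0 : ℝ) < (L : ℝ) ^ j := by positivity
  have hLk : (0 : ℝ) < (L : ℝ) ^ k := by positivity
  have hjk : (L : ℝ) ^ j ≤ (L : ℝ) ^ k := pow_le_pow_right₀ hL1r hj
  have hinv : ((L : ℝ) ^ k)⁻¹ ≤ ((L : ℝ) ^ j)⁻¹ := by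
    rw [inv_le_inv₀ hLk hLj]; exact hjk
  have h1 : α₀ * (((L : ℝ) ^ k)⁻¹) ^ 2 ≤ α₀ * (((L : ℝ) ^ j)⁻¹) ^ 2 :=
    mul_le_mul_of_nonneg_left (pow_le_pow_left₀ (by positivity) hinv 2) hα.le
  have hjb' : (L : ℝ) ^ j * b' ≤ (L : ℝ) ^ k * b' := mul_le_mul_of_nonneg_right hjk hb'
  have hjρ : (L : ℝ) ^ j * ρ ≤ (L : ℝ) ^ k * ρ := mul_le_mul_of_nonneg_right hjk hρ.le
  have hLjb' : 0 ≤ (L : ℝ) ^ j * b' := by positivity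
  have hLjρ : 0 ≤ (L : ℝ) ^ j * ρ := by positivity
  have hLkρ : 0 ≤ (L : ℝ) ^ k * ρ := by positivity
  have h2 : Real.exp (4 * (800 * ((d : ℝ) + 1) ^ 2 * ((d : ℝ) + 4)) * α₀)
        * (1 + 8 * (131072 * ((d : ℝ) + 1) ^ 2) * ((L : ℝ) ^ j * b'))
      ≤ Real.exp (4 * (800 * ((d : ℝ) + 1) ^ 2 * ((d : ℝ) + 4)) * α₀)
        * (1 + 8 * (131072 * ((d : ℝ) + 1) ^ 2) * ((L : ℝ) ^ k * b')) :=
    mul_le_mul_of_nonneg_left (by nlinarith) (Real.exp_pos _).le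
  have h4 : 409600 * ((d : ℝ) + 1) ^ 2 * ((L : ℝ) ^ j * b') ≤ 409600 * ((d : ℝ) + 1) ^ 2 * ((L : ℝ) ^ k * b') :=
    mul_le_mul_of_nonneg_left hjb' (by positivity)
  have h5 : Real.exp (4480 * ((d : ℝ) + 1) ^ 2 * ((d : ℝ) + 4) * α₀ + 240000 * ((d : ℝ) + 1) ^ 3 * ((L : ℝ) ^ j * b'))
          * (1 + 8 * (2097152 * ((d : ℝ) + 1) ^ 2) * ((L : ℝ) ^ j * ρ))
      ≤ Real.exp (4480 * ((d : ℝ) + 1) ^ 2 * ((d : ℝ) + 4) * α₀ + 240000 * ((d : ℝ) + 1) ^ 3 * ((L : ℝ) ^ k * b'))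
          * (1 + 8 * (2097152 * ((d : ℝ) + 1) ^ 2) * ((L : ℝ) ^ k * ρ)) := by
    gcongr Real.exp (_ + _ * ?_) * (1 + _ * ?_)
  exact ⟨h52.trans_le h1, h2.trans hsmall', by linarith, h4.trans hb'1, h5.trans hsmall, by linarith⟩

include hL hG hU₀ hα hα3 hα8 h52 hb' hB' hsmall' hc₃' hb'1 hρ hsmall hc₃ ha in
/-- **`C_j(U′U₀, ins_S ·)(c)` IS FRÉCHET DIFFERENTIABLE** at every point of the polydisc `‖a_s‖ ≤ ρ`, `j ≤ k` — the differential
(137) is a continuous LINEAR FUNCTIONAL of `δA`, at the complex background: `Q_j(U′U₀, ins_S ·)(c)` is analytic there (Prop. 7 at the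
complex level backgrounds, `B7Prop7Levels.prop7_analyticAt`) and `LʲηQ_j(U′U₀)(ins_S ·)(c)` is a continuous linear form
(`B7Prop7Ck.clm_linCovIter_cplx_ins`). [cite: Balaban1985Averaging, Proposition 7 p.43, (137) p.39, (134) p.38] -/
theorem hasFDerivAt_CCovIter_cplx_ins {j : ℕ} (hj : j ≤ k) (z : Site d) (κ : Fin d) :
    HasFDerivAt (fun a' : S → 𝔸 => CCovIter L (expCfg B' * U₀) (insCfg S a') j z κ)
      (fderiv ℂ (fun a' : S → 𝔸 => CCovIter L (expCfg B' * U₀) (insCfg S a') j z κ) a) a := by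
  have hLkρ : 0 ≤ (L : ℝ) ^ k * ρ := by positivity
  have hc₃4 : 2 * ((L : ℝ) ^ k * ρ) ≤ c3 d L / 4 := by linarith
  have hlog : AnalyticAt ℂ (fun a' : S → 𝔸 => logCovIter L (expCfg B' * U₀) (insCfg S a') j z κ) a :=
    prop7_analyticAt L hL hG k U₀ hU₀ hα hα3 hα8 h52 (fun _ : S → 𝔸 => B') (fun x κ' => analyticAt_const) hb' hB' hsmall'
      hc₃' hb'1 (fun a' : S → 𝔸 => insCfg S a') (fun x κ' => analyticAt_insCfg S x κ' a) hρ.le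
      (fun x κ' => norm_insCfg_le_of_le hρ.le ha x κ') hsmall hc₃4 j hj z κ
  obtain ⟨h52j, hsmall'j, hc₃'j, hb'1j, hsmallj, hc₃j⟩ :=
    regime_level L hL k U₀ hα h52 hb' hsmall' hc₃' hb'1 hρ hsmall hc₃ hj
  obtain ⟨Λ, hΛ⟩ := clm_linCovIter_cplx_ins L hL hG j U₀ hU₀ hα hα3 hα8 h52j B' hb' hB' hsmall'j hc₃'j hb'1j hρ hsmallj hc₃j
    S z κ
  have hlin : DifferentiableAt ℂ (fun a' : S → 𝔸 => linCovIter L (expCfg B' * U₀) (insCfg S a') j z κ) a := by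
    have : (fun a' : S → 𝔸 => linCovIter L (expCfg B' * U₀) (insCfg S a') j z κ) = fun a' => Λ a' :=
      funext fun a' => (hΛ a').symm
    rw [this]; exact Λ.differentiableAt
  have hC : DifferentiableAt ℂ (fun a' : S → 𝔸 => CCovIter L (expCfg B' * U₀) (insCfg S a') j z κ) a :=
    hlog.differentiableAt.sub hlin
  exact hC.hasFDerivAt

include hL hG hU₀ hα hα3 hα8 h52 hb' hB' hsmall' hc₃' hb'1 hE hdX hρ hsmall hc₃ hβ ha in
/-- **THE DERIVATIVE ON A SINGLE-BOND DIRECTION IS THE PER-BOND COLUMN**, at `U′U₀`: `D[C_j(U′U₀, ins_S ·)(c)](a)(X·e_s) = dC_j(U′U₀,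
ins_S a; X·δ_s)(c)` (the column bounded by `B7Prop5Cplx.prop5_cplx_157_uniform`) — (138) «the functional derivative coincides with
partial derivatives»: uniqueness of the derivative along the inserted line `ins_S(a + tX·e_s) = ins_S a + t·bump_s X`.
[cite: Balaban1985Averaging, (137)–(138) p.39, Proposition 7 p.43] -/
theorem fderiv_CCovIter_cplx_ins_single {j : ℕ} (hj : j ≤ k) (z : Site d) (κ : Fin d) (s : S) (X : 𝔸) :
    fderiv ℂ (fun a' : S → 𝔸 => CCovIter L (expCfg B' * U₀) (insCfg S a') j z κ) a (Pi.single s X) =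
      dCov L (expCfg B' * U₀) (insCfg S a) (bump s.1.1 s.1.2 X) j z κ := by
  have hB : ∀ x κ', ‖insCfg S a x κ'‖ ≤ ρ := fun x κ' => norm_insCfg_le_of_le hρ.le ha x κ'
  -- the per-bond line derivative of `prop5_cplx_157_uniform` at `B = ins_S a` …
  obtain ⟨hline, -, -⟩ := prop5_cplx_157_uniform L hL hG k U₀ hU₀ hα hα3 hα8 h52 B' hb' hB' hsmall' hc₃' hb'1 hE hdX
    (insCfg S a) hρ.le hB hsmall hc₃ hβ s.1.1 s.1.2 X hj z κ
  -- … read inside `𝔸^S` along `t ↦ a + t·X·e_s`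
  have hline' : HasLineDerivAt ℂ (fun a' : S → 𝔸 => CCovIter L (expCfg B' * U₀) (insCfg S a') j z κ)
      (dCov L (expCfg B' * U₀) (insCfg S a) (bump s.1.1 s.1.2 X) j z κ) a (Pi.single s X) := by
    have h1 : HasDerivAt (fun t : ℂ => CCovIter L (expCfg B' * U₀) (insCfg S a + t • bump s.1.1 s.1.2 X) j z κ)
        (dCov L (expCfg B' * U₀) (insCfg S a) (bump s.1.1 s.1.2 X) j z κ) 0 := hline
    show HasDerivAt (fun t : ℂ => CCovIter L (expCfg B' * U₀) (insCfg S (a + t • (Pi.single s X : S → 𝔸))) j z κ) _ 0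
    refine h1.congr_of_eventuallyEq (Filter.Eventually.of_forall fun t => ?_)
    simp only [insCfg_line]
  -- the Fréchet derivative evaluated on `X·e_s` is a line derivative too; line derivatives are unique
  have hF := (hasFDerivAt_CCovIter_cplx_ins L hL hG k U₀ hU₀ hα hα3 hα8 h52 B' hb' hB' hsmall' hc₃' hb'1 hρ hsmall hc₃ S ha
    hj z κ).hasLineDerivAt (Pi.single s X)
  rw [← hF.lineDeriv, hline'.lineDeriv]

include hL hG hU₀ hα hα3 hα8 h52 hb' hB' hsmall' hc₃' hb'1 hE hdX hρ hsmall hc₃ hβ ha in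
/-- **(149)/(157) IN THE PRINTED PAIRING FORM, AT THE COMPLEX BACKGROUND `U′U₀`, k-UNIFORM, UNIFORMLY IN `U′`**: for every `j ≤ k`,
every bond `c` of the `j`-th lattice and EVERY variation `δa ∈ 𝔸^S`, `‖⟨(δ/δA)C_j(U′U₀, ins_S a), δa⟩(c)‖ ≤ C₃·(Lʲ)²ρ·Σ_{s∈S} kerQdd(c,
s)·‖δa_s‖` — «|⟨(δ/δA)C_j(U₀, A), δA⟩| ≦ C₃|A|Q″_j|δA|» read at `U′U₀` («Proposition 5 may be extended to include … uniformity
statements»), `C₃ = C3Cplx d L` independent of `U′`: the derivative is linear, `δa = Σ_s δa_s·e_s`, and each column is bounded by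
`prop5_cplx_157_uniform` (zero off the box). [cite: Balaban1985Averaging, (149) p.40, (157) p.42, (137)–(138) p.39, Proposition 7 p.43] -/
theorem ineq149_cplx_pairing {j : ℕ} (hj : j ≤ k) (z : Site d) (κ : Fin d) (δa : S → 𝔸) :
    HasFDerivAt (fun a' : S → 𝔸 => CCovIter L (expCfg B' * U₀) (insCfg S a') j z κ)
        (fderiv ℂ (fun a' : S → 𝔸 => CCovIter L (expCfg B' * U₀) (insCfg S a') j z κ) a) a ∧
      ‖fderiv ℂ (fun a' : S → 𝔸 => CCovIter L (expCfg B' * U₀) (insCfg S a') j z κ) a δa‖ ≤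
        C3Cplx d L * (((L : ℝ) ^ j) ^ 2 * ρ) * ∑ s : S, kerQdd L j z κ s.1.1 s.1.2 * ‖δa s‖ := by
  classical
  refine ⟨hasFDerivAt_CCovIter_cplx_ins L hL hG k U₀ hU₀ hα hα3 hα8 h52 B' hb' hB' hsmall' hc₃' hb'1 hρ hsmall hc₃ S ha hj z κ,
    ?_⟩
  set Λ := fderiv ℂ (fun a' : S → 𝔸 => CCovIter L (expCfg B' * U₀) (insCfg S a') j z κ) a with hΛ
  have hB : ∀ x κ', ‖insCfg S a x κ'‖ ≤ ρ := fun x κ' => norm_insCfg_le_of_le hρ.le ha x κ'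
  -- `δa = Σ_s δa_s·e_s` and linearity
  have hsum : Λ δa = ∑ s : S, Λ (Pi.single s (δa s)) := by
    conv_lhs => rw [← Finset.univ_sum_single δa]
    rw [map_sum]
  -- each column
  have hcol : ∀ s : S, ‖Λ (Pi.single s (δa s))‖ ≤
      C3Cplx d L * (((L : ℝ) ^ j) ^ 2 * ρ) * (kerQdd L j z κ s.1.1 s.1.2 * ‖δa s‖) := by
    intro s
    rw [hΛ, fderiv_CCovIter_cplx_ins_single L hL hG k U₀ hU₀ hα hα3 hα8 h52 B' hb' hB' hsmall' hc₃' hb'1 hE hdX hρ hsmall hc₃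
      hβ S ha hj z κ s (δa s)]
    obtain ⟨-, hbd, hloc⟩ := prop5_cplx_157_uniform L hL hG k U₀ hU₀ hα hα3 hα8 h52 B' hb' hB' hsmall' hc₃' hb'1 hE hdX
      (insCfg S a) hρ.le hB hsmall hc₃ hβ s.1.1 s.1.2 (δa s) hj z κ
    by_cases hin : BondIn (loK L j z) (bondHiK L j z κ) s.1.1 s.1.2
    · rw [kerQdd_of_bondIn hin]
      refine hbd.trans (le_of_eq ?_)
      ring
    · simp only [hloc hin, kerQdd_of_not_bondIn hin, norm_zero, zero_mul, mul_zero, le_refl]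
  calc ‖Λ δa‖ = ‖∑ s : S, Λ (Pi.single s (δa s))‖ := by rw [hsum]
    _ ≤ ∑ s : S, ‖Λ (Pi.single s (δa s))‖ := norm_sum_le _ _
    _ ≤ ∑ s : S, C3Cplx d L * (((L : ℝ) ^ j) ^ 2 * ρ) * (kerQdd L j z κ s.1.1 s.1.2 * ‖δa s‖) :=
        sum_le_sum fun s _ => hcol s
    _ = C3Cplx d L * (((L : ℝ) ^ j) ^ 2 * ρ) * ∑ s : S, kerQdd L j z κ s.1.1 s.1.2 * ‖δa s‖ := by rw [Finset.mul_sum]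

include hL hG hU₀ hα hα3 hα8 h52 hb' hB' hsmall' hc₃' hb'1 hE hdX hρ hsmall hc₃ hβ ha in
/-- (149)/(157) at `U′U₀` in the pairing form, DISPLAYED with the differential (137) `⟨δF/δA, δA⟩ = (d/dt)F(A + tδA)|_{t=0}`
(`B7Ineq148.dPair`): `‖dC_j(U′U₀, ins_S a; ins_S δa)(c)‖ ≤ C₃·(Lʲ)²ρ·Σ_{s∈S} kerQdd(c, s)·‖δa_s‖`.
[cite: Balaban1985Averaging, (149) p.40, (137) p.39, Proposition 7 p.43] -/
theorem ineq149_cplx_pairing_dPair {j : ℕ} (hj : j ≤ k) (z : Site d) (κ : Fin d) (δa : S → 𝔸) :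
    ‖dPair (fun a' : S → 𝔸 => CCovIter L (expCfg B' * U₀) (insCfg S a') j z κ) a δa‖ ≤
      C3Cplx d L * (((L : ℝ) ^ j) ^ 2 * ρ) * ∑ s : S, kerQdd L j z κ s.1.1 s.1.2 * ‖δa s‖ := by
  obtain ⟨hF, hbd⟩ := ineq149_cplx_pairing L hL hG k U₀ hU₀ hα hα3 hα8 h52 B' hb' hB' hsmall' hc₃' hb'1 hE hdX hρ hsmall hc₃ hβ
    S ha hj z κ δa
  rwa [dPair_eq_fderiv hF.differentiableAt]

include hL hG hU₀ hα hα3 hα8 h52 hb' hB' hsmall' hc₃' hb'1 hE hdX hρ hsmall hc₃ hβ ha in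
/-- **(149)/(157) AT `U′U₀` AS AN OPERATOR BOUND** on the linear functional `D[C_j(U′U₀, ins_S ·)(c)](a) : 𝔸^S → 𝔸` (sup norm on
`𝔸^S`): `‖D[C_j(U′U₀, ins_S ·)(c)](a)‖ ≤ 2d·C₃·(Lʲ)²ρ` — (149) with the count `Σ_s kerQdd(c, s) ≤ 2d` of (141)/(142)
(`B7Ineq149Pairing.sum_kerQdd_mul_norm_le`); constants independent of `U′` and of `j ≤ k`.
[cite: Balaban1985Averaging, (149) p.40, (157) p.42, (141)–(142) p.39, Proposition 7 p.43] -/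
theorem opNorm_fderiv_CCovIter_cplx_ins_le {j : ℕ} (hj : j ≤ k) (z : Site d) (κ : Fin d) :
    ‖fderiv ℂ (fun a' : S → 𝔸 => CCovIter L (expCfg B' * U₀) (insCfg S a') j z κ) a‖ ≤
      2 * d * (C3Cplx d L * (((L : ℝ) ^ j) ^ 2 * ρ)) := by
  have hL1 : 1 ≤ L := le_trans (by norm_num) hL
  have hC := (C3Cplx_pos d hL1).le
  have hK : 0 ≤ C3Cplx d L * (((L : ℝ) ^ j) ^ 2 * ρ) := by positivity
  refine ContinuousLinearMap.opNorm_le_bound _ (by positivity) fun v => ?_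
  obtain ⟨-, hbd⟩ := ineq149_cplx_pairing L hL hG k U₀ hU₀ hα hα3 hα8 h52 B' hb' hB' hsmall' hc₃' hb'1 hE hdX hρ hsmall hc₃ hβ
    S ha hj z κ v
  refine hbd.trans ?_
  calc C3Cplx d L * (((L : ℝ) ^ j) ^ 2 * ρ) * ∑ s : S, kerQdd L j z κ s.1.1 s.1.2 * ‖v s‖
      ≤ C3Cplx d L * (((L : ℝ) ^ j) ^ 2 * ρ) * (2 * d * ‖v‖) :=
        mul_le_mul_of_nonneg_left (sum_kerQdd_mul_norm_le S L hL1 j z κ v) hK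
    _ = 2 * d * (C3Cplx d L * (((L : ℝ) ^ j) ^ 2 * ρ)) * ‖v‖ := by ring

end Regime

end Literature.MathematicalPhysics.QuantumFieldTheory.Balaban1983to89.B7Ineq149CplxPairing
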